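import Mathlib
import HarnessLib

/-!
# `TypeTwoEternal.EternalExtraction` (item stmt-NavierStokesRegularity-18163) — tools:
# doubling cells of every weight from the failure of the Type-I rate

Helper file for the support item `Theses.TypeTwoEternal.EternalExtraction`. Pure bookkeeping
about a field `w : ℝ → ℝ³ → ℝ³` on `[0, T₁) × ℝ³` (no equation is used): a DOUBLING CELL of the
route `TypeTwoEternal` is a triple `(T', t₀, x₀)`, `0 ≤ t₀ < T' < T₁`, at which the weighted size
`F(t, x) = ‖w(t, x)‖ √(T' − t)` is maximal over `[0, T'] × ℝ³` up to the factor `2`; its weight is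
`F(t₀, x₀)`. If `w` is bounded on every `[0, T'] × ℝ³` and the Type-I rate FAILS quantitatively
("`‖w(τ, x)‖² (T₁ − τ)` is unbounded as `τ ↑ T₁`"), cells of every weight exist
(`exists_weighted_cell`): near-maximisers of the bounded function `F` on `[0, T'] × ℝ³` for `T'`
slightly beyond a time where the rate fails (no point-picking lemma is needed for this factor-`2`,
global-in-space form of the cells).

HONEST FRAMING: bookkeeping for HYPOTHETICAL blow-up profiles (other route, not a pub-ns-dss cell
file); nothing here bears on the regularity problem itself.
-/

noncomputable section

set_option linter.dupNamespace false

namespace Summit.NavierStokesRegularity.NavierStokesRegularity.Theorems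

open MeasureTheory Set Function Filter Topology TopologicalSpace Metric
open scoped NNReal ENNReal

namespace EternalExtraction

/-- **Doubling cells of every weight** (module docstring): for `w` bounded on every
`[0, T'] × ℝ³`, `T' < T₁`, with `‖w(τ, x)‖²(T₁ − τ)` unbounded as `τ ↑ T₁`, and every `K`, there
is a cell `0 ≤ t₀ < T' < T₁`, `x₀`, of weight `‖w(t₀, x₀)‖ √(T' − t₀) ≥ K`, with
`‖w(t, x)‖ √(T' − t) ≤ 2 ‖w(t₀, x₀)‖ √(T' − t₀)` on `[0, T'] × ℝ³`. [folklore] -/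
theorem exists_weighted_cell {T₁ : ℝ} (hT₁ : 0 < T₁)
    {w : ℝ → EuclideanSpace ℝ (Fin 3) → EuclideanSpace ℝ (Fin 3)}
    (hbdd : ∀ T' < T₁, ∃ Mb : ℝ, ∀ σ ∈ Icc (0 : ℝ) T', ∀ y, ‖w σ y‖ ≤ Mb)
    (hnotI : ∀ C : ℝ, ∀ τ₁ < T₁, ∃ τ ∈ Ioo τ₁ T₁, 0 ≤ τ ∧
      ∃ x : EuclideanSpace ℝ (Fin 3), C < ‖w τ x‖ ^ 2 * (T₁ - τ))
    (K : ℝ) :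
    ∃ (T' t₀ : ℝ) (x₀ : EuclideanSpace ℝ (Fin 3)), 0 < T' ∧ T' < T₁ ∧ 0 ≤ t₀ ∧ t₀ < T' ∧
      K ≤ ‖w t₀ x₀‖ * Real.sqrt (T' - t₀) ∧
      ∀ t ∈ Icc (0 : ℝ) T', ∀ x, ‖w t x‖ * Real.sqrt (T' - t) ≤
        2 * (‖w t₀ x₀‖ * Real.sqrt (T' - t₀)) := by
  -- a time where the rate fails at level `16 K'²`, `K' = max K 1`
  set K' : ℝ := max K 1 with hK'
  have hK'1 : 1 ≤ K' := le_max_right _ _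
  obtain ⟨τ, hτ, hτ0, x₁, hx₁⟩ := hnotI (16 * K' ^ 2) (T₁ / 2) (by linarith)
  -- the cell horizon `T' = (τ + T₁)/2`
  obtain ⟨T', hT'⟩ : ∃ T' : ℝ, T' = (τ + T₁) / 2 := ⟨_, rfl⟩
  have hT'T : T' < T₁ := by rw [hT']; linarith [hτ.2]
  have hτT' : τ < T' := by rw [hT']; linarith [hτ.2]
  have hT'pos : 0 < T' := by rw [hT']; linarith [hτ.1]
  -- the weighted size and its supremum over `[0, T'] × ℝ³`
  obtain ⟨F, hF⟩ : ∃ F : ℝ × EuclideanSpace ℝ (Fin 3) → ℝ,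
      ∀ p, F p = ‖w p.1 p.2‖ * Real.sqrt (T' - p.1) := ⟨_, fun _ => rfl⟩
  obtain ⟨Mb, hMb⟩ := hbdd T' hT'T
  have hF0 : ∀ p, 0 ≤ F p := fun p => by rw [hF]; positivity
  have hba : BddAbove (F '' (Icc (0 : ℝ) T' ×ˢ univ)) := by
    refine ⟨|Mb| * Real.sqrt T', ?_⟩
    rintro _ ⟨p, hp, rfl⟩
    rw [hF]
    have h1 : ‖w p.1 p.2‖ ≤ |Mb| := (hMb p.1 hp.1 p.2).trans (le_abs_self _)
    have h2 : Real.sqrt (T' - p.1) ≤ Real.sqrt T' := Real.sqrt_le_sqrt (by linarith [hp.1.1])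
    exact mul_le_mul h1 h2 (Real.sqrt_nonneg _) (abs_nonneg _)
  have hmem₁ : (τ, x₁) ∈ Icc (0 : ℝ) T' ×ˢ (univ : Set (EuclideanSpace ℝ (Fin 3))) :=
    ⟨⟨hτ0, hτT'.le⟩, mem_univ _⟩
  have hne : (F '' (Icc (0 : ℝ) T' ×ˢ univ)).Nonempty := ⟨_, ⟨_, hmem₁, rfl⟩⟩
  obtain ⟨S, hS⟩ : ∃ S : ℝ, S = sSup (F '' (Icc (0 : ℝ) T' ×ˢ univ)) := ⟨_, rfl⟩
  have hle : ∀ p ∈ Icc (0 : ℝ) T' ×ˢ (univ : Set (EuclideanSpace ℝ (Fin 3))), F p ≤ S :=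
    fun p hp => by rw [hS]; exact le_csSup hba ⟨p, hp, rfl⟩
  -- the rate failure makes the supremum large: `F(τ, x₁) > 2K'`
  have hFτ : 2 * K' < F (τ, x₁) := by
    rw [hF]
    have h1 : T' - τ = (T₁ - τ) / 2 := by rw [hT']; ring
    have h2 : (2 * K') ^ 2 < (‖w τ x₁‖ * Real.sqrt (T' - τ)) ^ 2 := by
      have h3 : (‖w τ x₁‖ * Real.sqrt (T' - τ)) ^ 2 = ‖w τ x₁‖ ^ 2 * ((T₁ - τ) / 2) := by
        rw [mul_pow, Real.sq_sqrt (by linarith), h1]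
      rw [h3, show (2 * K') ^ 2 = 4 * K' ^ 2 by ring,
        show ‖w τ x₁‖ ^ 2 * ((T₁ - τ) / 2) = ‖w τ x₁‖ ^ 2 * (T₁ - τ) / 2 by ring]
      linarith [sq_nonneg K']
    by_contra hcon
    push Not at hcon
    have : (‖w τ x₁‖ * Real.sqrt (T' - τ)) ^ 2 ≤ (2 * K') ^ 2 :=
      pow_le_pow_left₀ (by positivity) hcon 2
    linarith
  have hS2 : 2 * K' < S := hFτ.trans_le (hle _ hmem₁)
  have hSpos : 0 < S := by linarith
  -- a near-maximiser
  have hlt : S / 2 < sSup (F '' (Icc (0 : ℝ) T' ×ˢ univ)) := by rw [← hS]; linarith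
  obtain ⟨_, ⟨p₀, hp₀, rfl⟩, hp₀S⟩ := exists_lt_of_lt_csSup hne hlt
  have ht₀T' : p₀.1 < T' := by
    rcases hp₀.1.2.eq_or_lt with h | h
    · exfalso
      have : F p₀ = 0 := by rw [hF, h, sub_self, Real.sqrt_zero, mul_zero]
      linarith
    · exact h
  refine ⟨T', p₀.1, p₀.2, hT'pos, hT'T, hp₀.1.1, ht₀T', ?_, fun t ht x => ?_⟩
  · have h1 : K ≤ K' := le_max_left _ _
    have h2 : F p₀ = ‖w p₀.1 p₀.2‖ * Real.sqrt (T' - p₀.1) := hF p₀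
    linarith
  · have h1 : F (t, x) ≤ S := hle (t, x) ⟨ht, mem_univ _⟩
    have h2 : F (t, x) = ‖w t x‖ * Real.sqrt (T' - t) := hF (t, x)
    have h3 : F p₀ = ‖w p₀.1 p₀.2‖ * Real.sqrt (T' - p₀.1) := hF p₀
    linarith

end EternalExtraction

end Summit.NavierStokesRegularity.NavierStokesRegularity.Theorems

end
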